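import Literature.MathematicalPhysics.KineticTheory.FouriersLaw
import Mathlib.MeasureTheory.Constructions.Pi
import Mathlib.MeasureTheory.Measure.Lebesgue.Basic
import Mathlib.Analysis.SpecialFunctions.Pow.Real
import HarnessLib

/-!
# Barrier (AtomisticToContinuum / FouriersLaw): mass disorder does not make the harmonic chain a normal conductor

`Literature/Barriers/AtomisticToContinuum/` (D-0021 barrier catalogue), sub-problem `FouriersLaw`
(`Literature.MathematicalPhysics.KineticTheory.HeatConduction.FouriersLaw`: `J_N ∼ κ δT/N`, `0 < κ < ∞`, for the pinned anharmonic chain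
between Langevin baths).

## Source and printed statement

O. Ajanki, F. Huveneers, *Rigorous scaling law for the heat current in disordered harmonic
chain*, Comm. Math. Phys. **301** (2011) 841–883 (arXiv:1003.1076), §1.1 and Theorem 1.1
(arXiv label `thr:the scaling of the average current`).

The Casher–Lebowitz chain (§1.1): `H(q, p) = ∑_{k=1}^n p_k²/(2m_k) + ½ ∑_{k=0}^n (q_{k+1} - q_k)²`
with FIXED boundaries `q_0 = q_{n+1} = 0`; "adding white noise and a viscous friction terms to
the Hamiltonian equations of `p_1` and `p_n`: … `λ > 0` … `T_1 ≥ T_n > 0` …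
`dq_k = ∂H/∂p_k dt`, `dp_k = -∂H/∂q_k dt + (δ_{k,1} + δ_{k,n})(-λ p_k dt + √(2λ T_k m_k) dW_k)`";
"The resulting current, denoted by `J^CL_n(m_1,…,m_n)`, is then by definition the average rate at
which energy is carried from the left to the right heat bath over the stationary measure of
[the SDE] for fixed masses `m_k`."

Theorem 1.1: "Assume that the masses `(M_k : k ∈ ℕ)` are independent and identically
distributed. Suppose that the common probability distribution of the masses `M_k` admits a
density, compactly supported on `]0, ∞[`, continuously differentiable inside its support, with an
uniformly bounded derivative. Denote by `E[·]` the expectation over the masses. Then there exist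
`K, K' > 0` such that the heat current `J^CL_n` satisfies the relation
`K (T_1 - T_n)/n^{3/2} ≤ E[J^CL_n(M_1,…,M_n)] ≤ K' (T_1 - T_n)/n^{3/2}`."

Ibid. §2 (standing form of the hypothesis used in the proofs): the reduced masses
`B_k = (M_k - E M_k)/E M_k` "have a (Lebesgue) probability density `τ` that satisfies
`spt(τ) ⊂ [b_-, b_+]`, and `τ ∈ C¹([b_-, b_+])`, for some constants `-1 < b_- < b_+ < ∞`. Here
`C^k([a,b])` denotes a continuous function `f : [a,b] → ℝ` such that `d^j f/dx^j` exist for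
`j ≤ k`, and that these derivatives are bounded and continuous on `]a,b[`"; "these values [of the
constants] depend only on `τ, λ, T_1 - T_n` and `w_0`, but never on `w` or `n`". Ibid. p. 4:
"already in [Casher–Lebowitz 1971] it was argued that `E J^CL_n ≳ n^{-3/2}`. However, the line of
reasoning there contains an error which invalidates this lower bound …, and therefore no rigorous
upper nor lower bounds have been published for `E J^CL_n` until now"; §1: the `n^{-3/2}` law "was
conjectured by Visscher (see ref. 9 in [Casher–Lebowitz-71])".

Context printed ibid. §1: perfect harmonic crystal — current `∝ (T_1 - T_n)`, not the gradient
[RLL 1967]; Rubin–Greer model (reservoirs = semi-infinite harmonic chains): `E J^RG_n ∼ n^{-1/2}`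
proved by Verheggen 1979; localisation: `‖A_n(w)⋯A_1(w)‖ ∼ e^{γ(w)n}`, and "in the absence of an
external potential (pinning), the Lyapunov exponent scales like `w²`", so only modes with
`w²n ≲ 1` transmit. Dhar–Venkateshan–Lebowitz 2011, §I: "For the 1D disordered harmonic lattice
without stochasticity the effect of localization due to disorder leads, in the presence of
pinning, to an exponential decay of the heat current as a function of the length. In the absence
of pinning the conductivity depends on the boundary conditions either growing as `√N` or
decaying as `1/√N`." Dhar 2001 (Abstract and p. 4): the exponent "depends not just on the
system itself but also on the spectral properties of the fluctuation and noise used to model the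
heat baths … for fixed boundaries `J ∼ 1/N^{3/2}`, while for free boundaries `J ∼ 1/N^{1/2}`. For
other choices we find that one can get other power laws including the 'Fourier behaviour'
`J ∼ 1/N`" (bath self-energy `A(ω) ∼ 1 - i sgn(ω) ω^s` gives `α = s/2` for `s ≥ 1`, `s = 2` being
Fourier-like; semi-rigorous). Dhar 2008 §3.4.1 (p. 17): "In the case where all sites of the chain
are pinned … the current decays exponentially with `N` and this was proved in [Dhar–Lebowitz 2008]"."

## Contents

* The Casher–Lebowitz chain with arbitrary masses `m : Fin n → ℝ` on the tree's phase space
  `PhaseSpace n`: `clHamiltonian`, `clGenerator` (friction `λ`, noise `√(2λT m_k)` on the first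
  and last particle), `clIsSteadyState` (weak Fokker–Planck stationarity, as
  `OscillatorChain.IsSteadyState`, with `p_k²` integrable), `clLeftFlux` (mean power injected by
  the left bath, `λ(T_L - p_1²/m_1)`, the bath part of the generator applied to `H`).
* `AjankiHuveneers2011_scaling` — NAMED FACT: Theorem 1.1 with the density hypothesis in the
  §2 form (`τ` vanishes off some `[a, b] ⊂ (0, ∞)`, is continuous on `[a, b]`, and `C¹` with
  bounded derivative on `(a, b)`), packaged existentially over weak steady states
  (`clIsSteadyState`, the pattern of `OscillatorChain.IsSteadyState`); constants may depend on
  everything but `n`, and the two-sided bound is asserted for all large `n`. Declared in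
  `Literature.Barriers.AtomisticToContinuum`; the model in `Literature.HeatConduction`.

## Design notes

* Left flux as THE stationary current: in the stationary state the energy received from the left
  bath equals the energy delivered to the right one and the current through every bond ("average
  rate at which energy is carried from the left to the right heat bath"); the fact asserts the
  existence of steady states whose left flux obeys the printed bounds (true for the Gaussian
  stationary measures the theorem is about), so no uniqueness in the weak class is imported.
* Mass average: `∫ … d(Measure.pi (fun _ : Fin n => ρ))`, `ρ = τ · Lebesgue` the common law;
  integrability of `m ↦ J_n(m)` is part of the claim so that the lower bound is not about a junk
  Bochner value.
-/

noncomputable section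

open MeasureTheory Filter Topology
open scoped ContDiff

namespace Literature.Barriers.AtomisticToContinuum.HeatConduction

/-! ### The Casher–Lebowitz chain (arbitrary masses, walls at both ends) -/

/-- Hamiltonian of the Casher–Lebowitz chain with masses `m`: `∑_k p_k²/(2m_k) + ½∑_{k=0}^{n}(q_{k+1} - q_k)²`
with walls `q_0 = q_{n+1} = 0` (the two wall springs are the `k.val = 0` and `k.val = n-1`
terms). [cite: AjankiHuveneers2011, §1.1] -/
def clHamiltonian {n : ℕ} (m : Fin n → ℝ) (x : Literature.MathematicalPhysics.KineticTheory.HeatConduction.PhaseSpace n) : ℝ :=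
  (∑ k, x.2 k ^ 2 / (2 * m k)) +
    ((∑ k : Fin n, ∑ j : Fin n, if j.val = k.val + 1 then (x.1 j - x.1 k) ^ 2 else 0) +
      (∑ k : Fin n, if k.val = 0 then x.1 k ^ 2 else 0) +
      (∑ k : Fin n, if k.val = n - 1 then x.1 k ^ 2 else 0)) / 2

/-- Generator of the Casher–Lebowitz dynamics `dq_k = (p_k/m_k) dt`,
`dp_k = -∂_{q_k}H dt + (δ_{k,1} + δ_{k,n})(-λ p_k dt + √(2λ T_k m_k) dW_k)`:
`L f = ∑_k ((p_k/m_k) ∂_{q_k} f - ∂_{q_k}H ∂_{p_k} f) + λ ∑_{ends} (T_k m_k ∂²_{p_k} f - p_k ∂_{p_k} f)`.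
[cite: AjankiHuveneers2011, §1.1] -/
def clGenerator {n : ℕ} (m : Fin n → ℝ) (lam T_L T_R : ℝ) (f : Literature.MathematicalPhysics.KineticTheory.HeatConduction.PhaseSpace n → ℝ)
    (x : Literature.MathematicalPhysics.KineticTheory.HeatConduction.PhaseSpace n) : ℝ :=
  (∑ k, (x.2 k / m k * Literature.MathematicalPhysics.KineticTheory.HeatConduction.partialQ k f x - Literature.MathematicalPhysics.KineticTheory.HeatConduction.partialQ k (clHamiltonian m) x * Literature.MathematicalPhysics.KineticTheory.HeatConduction.partialP k f x)) +
    lam * ∑ k : Fin n,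
      ((if k.val = 0 then T_L * m k * Literature.MathematicalPhysics.KineticTheory.HeatConduction.partialP k (Literature.MathematicalPhysics.KineticTheory.HeatConduction.partialP k f) x - x.2 k * Literature.MathematicalPhysics.KineticTheory.HeatConduction.partialP k f x else 0) +
        (if k.val = n - 1 then T_R * m k * Literature.MathematicalPhysics.KineticTheory.HeatConduction.partialP k (Literature.MathematicalPhysics.KineticTheory.HeatConduction.partialP k f) x - x.2 k * Literature.MathematicalPhysics.KineticTheory.HeatConduction.partialP k f x
          else 0))

/-- Weak steady state of the Casher–Lebowitz chain: a probability measure with `∫ L f dμ = 0`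
for all smooth compactly supported `f` and square-integrable momenta ("the stationary measure of
[the SDE] for fixed masses"; same weak form as `OscillatorChain.IsSteadyState`).
[cite: AjankiHuveneers2011, §1.1] -/
def clIsSteadyState {n : ℕ} (m : Fin n → ℝ) (lam T_L T_R : ℝ) (μ : Measure (Literature.MathematicalPhysics.KineticTheory.HeatConduction.PhaseSpace n)) :
    Prop :=
  IsProbabilityMeasure μ ∧
    (∀ f : Literature.MathematicalPhysics.KineticTheory.HeatConduction.PhaseSpace n → ℝ, ContDiff ℝ ∞ f → HasCompactSupport f →
      ∫ x, clGenerator m lam T_L T_R f x ∂μ = 0) ∧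
    ∀ k : Fin n, Integrable (fun x : Literature.MathematicalPhysics.KineticTheory.HeatConduction.PhaseSpace n => x.2 k ^ 2) μ

/-- The mean power injected by the left bath, `λ (T_L - μ(p_1²)/m_1)` (the bath part of the
generator applied to `H` at the first particle); in a stationary state this is "the average
rate at which energy is carried from the left to the right heat bath". Written as a sum over
`k.val = 0` so that no `n > 0` hypothesis is needed. [cite: AjankiHuveneers2011, §1.1] -/
def clLeftFlux {n : ℕ} (m : Fin n → ℝ) (lam T_L : ℝ) (μ : Measure (Literature.MathematicalPhysics.KineticTheory.HeatConduction.PhaseSpace n)) : ℝ :=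
  ∑ k : Fin n, if k.val = 0 then ∫ x : Literature.MathematicalPhysics.KineticTheory.HeatConduction.PhaseSpace n, lam * (T_L - x.2 k ^ 2 / m k) ∂μ else 0

/-! ### API -/

/-- The generator annihilates constants. [folklore] -/
@[simp] theorem clGenerator_const {n : ℕ} (m : Fin n → ℝ) (lam T_L T_R c : ℝ)
    (x : Literature.MathematicalPhysics.KineticTheory.HeatConduction.PhaseSpace n) : clGenerator m lam T_L T_R (fun _ => c) x = 0 := by
  simp [clGenerator, Literature.MathematicalPhysics.KineticTheory.HeatConduction.partialQ, Literature.MathematicalPhysics.KineticTheory.HeatConduction.partialP]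

/-- The empty chain has no left flux. [folklore] -/
@[simp] theorem clLeftFlux_zero (m : Fin 0 → ℝ) (lam T_L : ℝ) (μ : Measure (Literature.MathematicalPhysics.KineticTheory.HeatConduction.PhaseSpace 0)) :
    clLeftFlux m lam T_L μ = 0 := by
  simp [clLeftFlux]

end Literature.Barriers.AtomisticToContinuum.HeatConduction

namespace Literature.Barriers.AtomisticToContinuum

open Literature.MathematicalPhysics.KineticTheory.HeatConduction HeatConduction

/-- Ajanki–Huveneers 2011, Theorem 1.1 (Casher–Lebowitz model; the `n^{-3/2}` law "was conjectured by Visscher (see ref. 9 in [Casher–Lebowitz-71])" [cite: AjankiHuveneers2011, §1]): if the masses are i.i.d. with a density `τ` vanishing off a compact interval `[a, b] ⊂ (0, ∞)`, continuous on `[a, b]` and `C¹` with bounded derivative on `(a, b)` (the §2 form of "compactly supported on `]0,∞[`, continuously differentiable inside its support, with an uniformly bounded derivative"), then for friction `λ > 0` and bath temperatures `T_L ≥ T_R > 0` there are constants `K, K' > 0` such that, for all large `n`, the mass-averaged stationary current obeys `K (T_L - T_R) n^{-3/2} ≤ E[J_n] ≤ K' (T_L - T_R) n^{-3/2}` — so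 the length-`n` conductivity `n E[J_n]/(T_L - T_R) ≍ n^{-1/2} → 0`: the disordered harmonic chain between white-noise Langevin baths with fixed walls is, on average, an insulator in the large-`n` limit, not a normal conductor. Vendored existentially over weak steady states (`clIsSteadyState`) with the left-bath flux `clLeftFlux` as the current.
BARRIER (D-0021), AtomisticToContinuum/FouriersLaw:
technique_class: quenched-disorder random-masses anderson-localization transfer-matrix random-matrix-products harmonic phonon-scattering-by-impurities (disorder as a substitute for anharmonicity); BARRIER AUDIT 2026-08-15 (`DisorderedHarmonicChainNarrow`, file `DisorderedHarmonicChainNarrow.lean`, both conjuncts proved): of this class the printed theorem and its mechanism (`γ(ω) ≍ σ²ω²`) cover exactly the I.I.D., LIGHT-TAILED sub-class — independent masses with a one-site density compactly supported in `(0, ∞)`, `d = 1`, white-noise baths; the exponent is a functional of the JOINT law of the masses (comonotone masses with the same marginals: exponent `0`, proved there; long-range correlated or heavy-tailed disorder: tunable exponents including the Fourier-like `-1`, evasions (d)–(e) below), so "quenched disorder" at large is NOT covered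
blocks: normal conduction (`E J_N ≍ N^{-1}`, `0 < κ < ∞`, the content of `OscillatorChain.FouriersLawFor`) for the HARMONIC chain with i.i.d. random masses between white-noise (Ornstein–Uhlenbeck) Langevin baths: with fixed walls `E J_N ≍ N^{-3/2}` (vendored here) [cite: AjankiHuveneers2011, Thm 1.1]; cited, not vendored: with free boundaries, or with Rubin–Greer semi-infinite harmonic reservoirs, `E J_N ≍ N^{-1/2}` [cite: Verheggen1979, main result as restated in AjankiHuveneers2011 §1] [cite: Dhar2008, §3.4.1], and with an on-site pinning at all sites (the case of `pinnedChain ω₂ 0 0 γ` with randomised masses) the current decays exponentially in `N` [cite: Dhar2008, §3.4.1 p. 17] [cite: DharVenkateshanLebowitz2011, §I]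
because: the stationary current is a bath-weighted frequency integral of `|v_nᵀ A_n(w)⋯A_1(w) v_1|^{-2}` over products of i.i.d. `2×2` transfer matrices; these grow like `e^{γ(w)n}` (localisation of the eigenmodes) with Lyapunov exponent `γ(w) ∼ w²` as `w → 0` when there is no pinning, so only the window `w ≲ n^{-1/2}` transmits, and the resulting exponent is fixed by how the bath vectors and the boundary conditions weight that window: `-3/2` for Ornstein–Uhlenbeck baths with fixed walls, `-1/2` for free boundaries / Rubin–Greer baths [cite: AjankiHuveneers2011, §1] [cite: Dhar2008, §3.4.1]
evasions_known: (a) energy-conserving bulk noise restores finite positive conductivity bounds for the disordered harmonic chain [cite: DharVenkateshanLebowitz2011, §I and §III] [cite: Bernardin2011, §4.3]; but for the PINNED disordered chain with weak noise `λ → 0` and anharmonicity `λ' ≤ λ` the Green–Kubo conductivity is `O(λ)` ("persistence of localization effects for a non-integrable dynamics") [cite: BernardinHuveneers2013, Abstract]; (b) anharmonicity plus disorder is observed numerically to give a diffusive regime, "whether the transition from an insulator to conductor occurs at zero or some finite small value of anharmonicity remains an open problem" [cite: DharVenkateshanLebowitz2011, §I]; (c) baths with other spectral properties: for generalised Langevin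 baths with self-energy `A(ω) ∼ 1 - i sgn(ω) ω^s` the (semi-rigorous) exponent is `α = s/2` (`s ≥ 1`), and `s = 2` gives the "Fourier behaviour" `J ∼ 1/N` for the same disordered harmonic chain [cite: Dhar2001, Abstract and p. 4]; the authors of the vendored theorem add that for the modified Casher–Lebowitz baths `μ̃(w) ∼ μ(sgn(w)|w|^s)` the law `E J ∼ n^{-(1+s/2)}` "can be proven rigorously by directly adapting the proof of Theorem 1.1", whereas the modified Rubin–Greer family `n^{-(1+|s-1|)/2}` (Fourier-like at `s = 2`) "does not follow directly … we believe it should not be too difficult to prove by using our results" [cite: AjankiHuveneers2011, §6.3]; (barrier audit 2026-08-15:) (d) long-range CORRELATED isotopic disorder, same white-noise Langevin baths, same fixed walls `q_0 = q_{N+1} = 0`: with disorder power spectrum `W(μ) ∼ μ^β` at `μ → 0` the perturbative inverse localisation length is `(σ²/2M²)(ω/ω_max)²W(2ω/ω_max)`, the number of extended modes `N_e ∼ N^{(1+β)/(2+β)}` and `κ ∼ N^{(β-1)/(β+2)}` (fixed walls), `N^{(β+1)/(β+2)}` (free); at `β = 1` (`χ(l) ∼ l^{-2}`) "the conductivity becomes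 independent of the size of the chain … Fourier's law emerges" — Matsuda–Ishii weak-coupling formula, second-order Lyapunov exponent, numerics (`σ² = 0.2`, 100 realisations), not a theorem [cite: HerreragonzalezIzrailevTessieri2015, Abstract, §3 and §4]; correlations delocalising a finite fraction of mid-spectrum modes give `κ ∝ N^α`, `α ∼ 1` [cite: HerreragonzalezIzrailevTessieri2010, Abstract and §1]; (e) HEAVY-TAILED (strong) i.i.d. weak-link disorder `P(K) ∝ K^{ε-1}` (outside the density class: couplings accumulate at `0`), harmonic-lead baths: conductance `∝ L^{-1/2}` (`ε > 2`), `L^{-1/ε}` (`1 < ε ≤ 2`), `L^{-1}` (`ε ≤ 1`, "normal") by mode counting with the strong-disorder scalings of the density of states and of the localisation length [cite: AmirOregImry2018, Abstract, Table I and eqs. (18), (20), (23)], confirmed numerically for strong impedance mismatch [cite: AshEtAl2020, Abstract and Conclusions]; (f) DIMENSION: for the `d = 3` mass-disordered harmonic crystal with white-noise baths `J ∼ N^{-1}` is predicted with fixed boundaries and with pinning (`N^{-3/4}` free; `d = 2`: `(ln N)^{-1/2}N^{-1}` fixed, `N^{-2/3}` free, `e^{-bN}` pinned) and "we numerically verify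 that the pinned three dimensional system satisfies Fourier's law" (sizes up to `N = 64`) [cite: ChaudhuriEtAl2010, Abstract, §3 and §4.2.2]; none of (d)–(f) is a theorem, and (d)–(e) are ballistic-mode-counting statements, not local equilibrium: for the isolated i.i.d.-disordered unpinned chain "the temperature profile remains frozen at any time scale, including the diffusive time scale … a vanishing thermal diffusivity" [cite: BernardinHuveneersOlla2018, §1.2]
scope_caveats: HARMONIC chain only, `d = 1`, white-noise Langevin baths with fixed walls only (the free-boundary, Rubin–Greer and pinned statements in `blocks:` are cited, not vendored), i.i.d. masses with a density of the §2 class (vanishing off `[a,b] ⊂ (0,∞)`, continuous on `[a,b]`, `C¹` with bounded derivative on `(a,b)`), and the statement is about the MASS-AVERAGED current (no almost-sure or single-realisation claim); the exponent is NOT universal — it depends on boundary conditions and on the bath spectral function, and special (non-Markovian) baths give `J ∼ 1/N` [cite: Dhar2001, Abstract] [cite: Dhar2008, §3.4.1], so the barrier is "no normal conduction from disorder alone with THESE baths", not "disorder never gives `1/N`"; nothing is printed here about the anharmonic `pinnedChain` of `Literature.MathematicalPhysics.KineticTheory.HeatConduction.FouriersLaw` beyond numerics and the weak-coupling result of (a);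 the Lean fact lets `K, K'` depend on `λ, T_L, T_R, τ`, asserts the two-sided bound for `n ≥ n₀` only (printed: all `n`), and takes the left-bath power in an existentially chosen weak steady state (`clIsSteadyState`) as the current rather than THE (Gaussian) stationary measure; (barrier audit 2026-08-15) of the statements cited in `blocks:` only the fixed-wall white-noise case (vendored; Lean statement found faithful to Thm 1.1 with the §2 density class) and the Rubin–Greer case [cite: Verheggen1979, main result as restated in AjankiHuveneers2011 §1 and §6.3] are theorems — the FREE-boundary white-noise law `N^{-1/2}` rests on heuristics and numerics [cite: Dhar2008, §3.4.1], the pinned exponential decay on a PRL-level argument (spectral gap + Furstenberg, almost-sure form; a finite number `n ≥ 2` of pinned sites is argued to give `κ ∼ N^{3/2-n}`) [cite: DharLebowitz2008, paragraph "Considering now the random mass harmonic pinned case" (arXiv:0708.4171 p. 3)] [cite: Dhar2008, §3.4.1], and self-averaging (typical = average) is assumed, not proved, in that literature; INDEPENDENCE and LIGHT TAILS of the mass law are load-bearing — see `technique_class`, evasions (d)–(e) and `DisorderedHarmonicChainNarrow` conjunct (2) (comonotone masses with the same marginals conduct ballistically, proved)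
status: theorem (established) [cite: AjankiHuveneers2011, Thm 1.1]
[cite: AjankiHuveneers2011, Thm 1.1, §2 and §6.3] [cite: CasherLebowitz1971, model as restated in AjankiHuveneers2011 §1.1] [cite: HerreragonzalezIzrailevTessieri2015, Abstract and §4] [cite: AmirOregImry2018, Table I] [cite: ChaudhuriEtAl2010, Abstract] [cite: BernardinHuveneersOlla2018, §1.2] -/
def AjankiHuveneers2011_scaling : Prop :=
  ∀ (τ : ℝ → ℝ) (a b : ℝ), 0 < a → a < b → (∀ s, 0 ≤ τ s) → (∀ s ∉ Set.Icc a b, τ s = 0) →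
    ContinuousOn τ (Set.Icc a b) → ContDiffOn ℝ 1 τ (Set.Ioo a b) →
    (∃ C : ℝ, ∀ s ∈ Set.Ioo a b, |deriv τ s| ≤ C) → ∫ s, τ s = 1 →
    ∀ (ρ : Measure ℝ) [IsProbabilityMeasure ρ],
      ρ = volume.withDensity (fun s => ENNReal.ofReal (τ s)) →
      ∀ lam T_L T_R : ℝ, 0 < lam → 0 < T_R → T_R ≤ T_L →
        ∃ K K' : ℝ, 0 < K ∧ 0 < K' ∧ ∃ n₀ : ℕ, ∀ n : ℕ, n₀ ≤ n →
          ∃ μ : (Fin n → ℝ) → Measure (PhaseSpace n),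
            (∀ m : Fin n → ℝ, (∀ k, 0 < m k) → clIsSteadyState m lam T_L T_R (μ m)) ∧
            Integrable (fun m => clLeftFlux m lam T_L (μ m)) (Measure.pi fun _ : Fin n => ρ) ∧
            K * (T_L - T_R) / (n : ℝ) ^ (3 / 2 : ℝ) ≤
                ∫ m, clLeftFlux m lam T_L (μ m) ∂(Measure.pi fun _ : Fin n => ρ) ∧
              ∫ m, clLeftFlux m lam T_L (μ m) ∂(Measure.pi fun _ : Fin n => ρ) ≤
                K' * (T_L - T_R) / (n : ℝ) ^ (3 / 2 : ℝ)

/-- Consequence of the fact for the conductivity: under `AjankiHuveneers2011_scaling`, along the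
steady-state family it provides, `n · E[J_n]/(T_L - T_R) ≤ K' n^{-1/2}` for large `n`, i.e. the
mass-averaged finite-size conductivity tends to zero (an insulator), whereas Fourier's law
would require a positive limit. Stated for `T_L > T_R`. [cite: AjankiHuveneers2011, Thm 1.1] -/
theorem AjankiHuveneers2011_scaling.conductivity_le (h : AjankiHuveneers2011_scaling)
    (τ : ℝ → ℝ) {a b : ℝ} (ha : 0 < a) (hab : a < b) (h0 : ∀ s, 0 ≤ τ s)
    (hoff : ∀ s ∉ Set.Icc a b, τ s = 0) (hcont : ContinuousOn τ (Set.Icc a b))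
    (hdiff : ContDiffOn ℝ 1 τ (Set.Ioo a b)) (hbd : ∃ C : ℝ, ∀ s ∈ Set.Ioo a b, |deriv τ s| ≤ C)
    (h4 : ∫ s, τ s = 1)
    (ρ : Measure ℝ) [IsProbabilityMeasure ρ]
    (hρ : ρ = volume.withDensity (fun s => ENNReal.ofReal (τ s)))
    {lam T_L T_R : ℝ} (hlam : 0 < lam) (hR : 0 < T_R) (hLR : T_R < T_L) :
    ∃ K' : ℝ, 0 < K' ∧ ∃ n₀ : ℕ, ∀ n : ℕ, n₀ ≤ n → 0 < n →
      ∃ μ : (Fin n → ℝ) → Measure (PhaseSpace n),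
        (∀ m : Fin n → ℝ, (∀ k, 0 < m k) → clIsSteadyState m lam T_L T_R (μ m)) ∧
        (n : ℝ) * (∫ m, clLeftFlux m lam T_L (μ m) ∂(Measure.pi fun _ : Fin n => ρ)) / (T_L - T_R)
          ≤ K' / Real.sqrt n := by
  obtain ⟨K, K', hK, hK', n₀, hn⟩ :=
    h τ a b ha hab h0 hoff hcont hdiff hbd h4 ρ hρ lam T_L T_R hlam hR hLR.le
  refine ⟨K', hK', n₀, fun n hn₀ hnpos => ?_⟩
  obtain ⟨μ, hst, -, -, hup⟩ := hn n hn₀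
  refine ⟨μ, hst, ?_⟩
  have hδ : 0 < T_L - T_R := sub_pos.mpr hLR
  have hnr : (0 : ℝ) < n := by exact_mod_cast hnpos
  -- `n * (K' δ / n^{3/2}) / δ = K' / √n`
  have h32 : (n : ℝ) ^ (3 / 2 : ℝ) = n * Real.sqrt n := by
    rw [show (3 / 2 : ℝ) = 1 + 1 / 2 by norm_num, Real.rpow_add hnr, Real.rpow_one,
      Real.sqrt_eq_rpow]
  calc (n : ℝ) * (∫ m, clLeftFlux m lam T_L (μ m) ∂(Measure.pi fun _ : Fin n => ρ)) / (T_L - T_R)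
      ≤ (n : ℝ) * (K' * (T_L - T_R) / (n : ℝ) ^ (3 / 2 : ℝ)) / (T_L - T_R) := by
        gcongr
    _ = K' / Real.sqrt n := by
        rw [h32]
        have hs : 0 < Real.sqrt n := Real.sqrt_pos.mpr hnr
        field_simp

end Literature.Barriers.AtomisticToContinuum

end
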